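import Mathlib

/-!
# Support item `SlabEnergyIdentity` (stmt-NavierStokesRegularity-16859), route PlaneEnergyCeiling:
  calculus on slabs `{a < x₂ < b}` of `ℝ³`

Helper file (Mathlib only) for the slab energy identity
`Summit.NavierStokesRegularity.NavierStokesRegularity.Theses.PlaneEnergyCeiling.SlabEnergyIdentity`.
Write `P y c = (y₀, y₁, c) ∈ ℝ³` for `y ∈ ℝ²`, `c ∈ ℝ` (in Lean `WithLp.toLp 2 ![y 0, y 1, c]`, the
parametrisation of the plane `{x₂ = c}` used by the route file) and `S(a,b) = {x | a < x₂ < b}`.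

* `exists_slabChart` — a measurable equivalence `e : ℝ × ℝ² ≃ᵐ ℝ³` with `e (c, y) = P y c`
  preserving Lebesgue measure (Mathlib `volume_preserving_piFinSuccAbove`,
  `PiLp.volume_preserving_toLp`, `PiLp.volume_preserving_ofLp`);
* `setIntegral_slab_eq_integral_integral`, `setIntegral_slab_eq_integral_setIntegral` — Fubini on
  the slab: `∫_{S(a,b)} g = ∫_{c ∈ (a,b)} ∫_y g (P y c) = ∫_y ∫_{c ∈ (a,b)} g (P y c)` for `g`
  integrable on `ℝ³`;
* `setIntegral_slab_fderiv_two` — for `φ ∈ C¹(ℝ³)` with `∂₂φ` integrable and the two boundary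
  slices integrable: `∫_{S(a,b)} ∂₂φ = ∫_y φ(P y b) − ∫_y φ(P y a)` (fundamental theorem of calculus
  on every vertical line);
* `setIntegral_slab_fderiv_zero`, `setIntegral_slab_fderiv_one` — `∫_{S(a,b)} ∂ᵥφ = 0` for the
  in-plane directions `v = e₀, e₁` when `φ`, `∂ᵥφ` are integrable (whole-plane integration by parts
  on almost every slice, Mathlib `integral_bilinear_hasLineDerivAt_right_eq_neg_left_of_integrable`);
* `sum_setIntegral_slab_fderiv` — the combination `Σⱼ ∫_{S(a,b)} ∂ⱼφⱼ = ∫_y φ₂(P y b) − ∫_y φ₂(P y a)`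
  (the divergence theorem on the slab for rapidly integrable fields, boundary = the two planes).

Elementary real analysis (Fubini + FTC + integration by parts without boundary terms); no fluid
mechanics enters.
-/

noncomputable section

-- Problem = summit for this single-conjunct summit: the duplicate namespace component is deliberate.
set_option linter.dupNamespace false

namespace Summit.NavierStokesRegularity.NavierStokesRegularity.Theorems.PlaneEnergyCeilingSlabEnergyIdentity

open MeasureTheory Set Filter Topology WithLp
open scoped ENNReal

/-! ### Coordinates of the plane parametrisation -/

/-- `(P y c)₂ = c`. -/
@[simp] theorem toLp_vec3_apply_two (y : EuclideanSpace ℝ (Fin 2)) (c : ℝ) : (toLp 2 ![y 0, y 1, c] : EuclideanSpace ℝ (Fin 3)) 2 = c := rfl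

/-- `(P y c)₀ = y₀`. -/
@[simp] theorem toLp_vec3_apply_zero (y : EuclideanSpace ℝ (Fin 2)) (c : ℝ) : (toLp 2 ![y 0, y 1, c] : EuclideanSpace ℝ (Fin 3)) 0 = y 0 :=
  rfl

/-- `(P y c)₁ = y₁`. -/
@[simp] theorem toLp_vec3_apply_one (y : EuclideanSpace ℝ (Fin 2)) (c : ℝ) : (toLp 2 ![y 0, y 1, c] : EuclideanSpace ℝ (Fin 3)) 1 = y 1 :=
  rfl

/-- The vertical line through `P y 0`: `P y c = P y 0 + c • e₂`. -/
theorem toLp_vec3_eq_add_smul (y : EuclideanSpace ℝ (Fin 2)) (c : ℝ) :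
    (toLp 2 ![y 0, y 1, c] : EuclideanSpace ℝ (Fin 3)) = toLp 2 ![y 0, y 1, 0] + c • EuclideanSpace.single 2 1 := by
  ext k
  fin_cases k <;> simp

/-- Translating the parameter in the plane translates the point in `ℝ³`, direction `e₀`. -/
theorem toLp_vec3_add_smul_single_zero (y : EuclideanSpace ℝ (Fin 2)) (c t : ℝ) :
    (toLp 2 ![(y + t • EuclideanSpace.single 0 1 : EuclideanSpace ℝ (Fin 2)) 0, (y + t • EuclideanSpace.single 0 1 : EuclideanSpace ℝ (Fin 2)) 1, c]
        : EuclideanSpace ℝ (Fin 3))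
      = toLp 2 ![y 0, y 1, c] + t • EuclideanSpace.single 0 1 := by
  ext k
  fin_cases k <;> simp

/-- Translating the parameter in the plane translates the point in `ℝ³`, direction `e₁`. -/
theorem toLp_vec3_add_smul_single_one (y : EuclideanSpace ℝ (Fin 2)) (c t : ℝ) :
    (toLp 2 ![(y + t • EuclideanSpace.single 1 1 : EuclideanSpace ℝ (Fin 2)) 0, (y + t • EuclideanSpace.single 1 1 : EuclideanSpace ℝ (Fin 2)) 1, c]
        : EuclideanSpace ℝ (Fin 3))
      = toLp 2 ![y 0, y 1, c] + t • EuclideanSpace.single 1 1 := by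
  ext k
  fin_cases k <;> simp

/-- `‖y‖ ≤ ‖P y c‖`: the plane parametrisation does not decrease norms. -/
theorem norm_le_norm_toLp_vec3 (y : EuclideanSpace ℝ (Fin 2)) (c : ℝ) : ‖y‖ ≤ ‖(toLp 2 ![y 0, y 1, c] : EuclideanSpace ℝ (Fin 3))‖ := by
  have h2 : ‖y‖ ^ 2 = y 0 ^ 2 + y 1 ^ 2 := by
    rw [EuclideanSpace.real_norm_sq_eq, Fin.sum_univ_two]
  have h3 : ‖(toLp 2 ![y 0, y 1, c] : EuclideanSpace ℝ (Fin 3))‖ ^ 2 = y 0 ^ 2 + y 1 ^ 2 + c ^ 2 := by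
    rw [EuclideanSpace.real_norm_sq_eq, Fin.sum_univ_three]
    rfl
  have : ‖y‖ ^ 2 ≤ ‖(toLp 2 ![y 0, y 1, c] : EuclideanSpace ℝ (Fin 3))‖ ^ 2 := by
    rw [h2, h3]; nlinarith [sq_nonneg c]
  exact le_of_sq_le_sq this (norm_nonneg _)

/-- The vertical line `c ↦ P y c` has velocity `e₂`. -/
theorem hasDerivAt_toLp_vec3 (y : EuclideanSpace ℝ (Fin 2)) (c : ℝ) :
    HasDerivAt (fun c : ℝ => (toLp 2 ![y 0, y 1, c] : EuclideanSpace ℝ (Fin 3))) (EuclideanSpace.single 2 1) c := by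
  have h := ((hasDerivAt_id c).smul_const (EuclideanSpace.single (2 : Fin 3) (1 : ℝ))).const_add
    (toLp 2 ![y 0, y 1, 0] : EuclideanSpace ℝ (Fin 3))
  simp only [id_eq, one_smul] at h
  have hfun : (fun c : ℝ => (toLp 2 ![y 0, y 1, c] : EuclideanSpace ℝ (Fin 3))) =
      fun c => toLp 2 ![y 0, y 1, 0] + c • EuclideanSpace.single 2 1 :=
    funext fun c' => toLp_vec3_eq_add_smul y c'
  rw [hfun]
  exact h

/-! ### The slab chart `ℝ × ℝ² ≃ᵐ ℝ³` -/

/-- **The slab chart.** There is a measurable equivalence `e : ℝ × ℝ² ≃ᵐ ℝ³` with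
`e (c, y) = (y₀, y₁, c)` which preserves Lebesgue measure (it is
`toLp ∘ (piFinSuccAbove _ 2)⁻¹ ∘ (id × ofLp)`, a composition of measure-preserving maps). -/
theorem exists_slabChart : ∃ e : ℝ × EuclideanSpace ℝ (Fin 2) ≃ᵐ (EuclideanSpace ℝ (Fin 3)), MeasurePreserving e volume volume ∧
    ∀ (c : ℝ) (y : EuclideanSpace ℝ (Fin 2)), e (c, y) = toLp 2 ![y 0, y 1, c] := by
  refine ⟨((MeasurableEquiv.refl ℝ).prodCongr (MeasurableEquiv.toLp 2 (Fin 2 → ℝ)).symm).trans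
      ((MeasurableEquiv.piFinSuccAbove (fun _ => ℝ) 2).symm.trans
        (MeasurableEquiv.toLp 2 (Fin 3 → ℝ))), ?_, ?_⟩
  · have h1 : MeasurePreserving
        ((MeasurableEquiv.refl ℝ).prodCongr (MeasurableEquiv.toLp 2 (Fin 2 → ℝ)).symm)
        volume volume :=
      (MeasurePreserving.id volume).prod
        (EuclideanSpace.volume_preserving_symm_measurableEquiv_toLp (Fin 2))
    have h2 : MeasurePreserving (MeasurableEquiv.piFinSuccAbove (fun _ : Fin 3 => ℝ) 2).symm
        volume volume :=
      (volume_preserving_piFinSuccAbove (fun _ => ℝ) 2).symm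
    have h3 : MeasurePreserving (MeasurableEquiv.toLp 2 (Fin 3 → ℝ)) volume volume :=
      PiLp.volume_preserving_toLp (Fin 3)
    exact h1.trans (h2.trans h3)
  · intro c y
    ext k
    fin_cases k <;> rfl

/-- The slab `S(a,b) = {a < x₂ < b}` pulls back to the box `(a,b) × ℝ²` under the slab chart. -/
theorem preimage_slab_eq {e : ℝ × EuclideanSpace ℝ (Fin 2) ≃ᵐ (EuclideanSpace ℝ (Fin 3))} (he : ∀ (c : ℝ) (y : EuclideanSpace ℝ (Fin 2)), e (c, y) = toLp 2 ![y 0, y 1, c])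
    (a b : ℝ) : e ⁻¹' {x : EuclideanSpace ℝ (Fin 3) | a < x 2 ∧ x 2 < b} = Ioo a b ×ˢ (univ : Set (EuclideanSpace ℝ (Fin 2))) := by
  ext ⟨c, y⟩
  simp [he]

/-- The slab `S(a,b)` is an open, hence measurable, set. -/
theorem measurableSet_slab (a b : ℝ) : MeasurableSet {x : EuclideanSpace ℝ (Fin 3) | a < x 2 ∧ x 2 < b} := by
  have hc : Continuous fun x : EuclideanSpace ℝ (Fin 3) => x 2 := (EuclideanSpace.proj (2 : Fin 3)).continuous
  exact ((isOpen_lt continuous_const hc).inter (isOpen_lt hc continuous_const)).measurableSet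

/-! ### Fubini on the slab -/

section Fubini

variable {F : Type*} [NormedAddCommGroup F] [NormedSpace ℝ F]

/-- **Fubini on the slab**, heights outside: for `g` integrable on `ℝ³`,
`∫_{S(a,b)} g = ∫_{c ∈ (a,b)} ∫_y g (y₀, y₁, c)`. -/
theorem setIntegral_slab_eq_integral_integral {g : EuclideanSpace ℝ (Fin 3) → F} (hg : Integrable g) (a b : ℝ) :
    ∫ x in {x : EuclideanSpace ℝ (Fin 3) | a < x 2 ∧ x 2 < b}, g x =
      ∫ c in Ioo a b, ∫ y : EuclideanSpace ℝ (Fin 2), g (toLp 2 ![y 0, y 1, c]) := by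
  obtain ⟨e, he, heq⟩ := exists_slabChart
  have hpre := preimage_slab_eq heq a b
  have h1 : ∫ x in {x : EuclideanSpace ℝ (Fin 3) | a < x 2 ∧ x 2 < b}, g x =
      ∫ z in Ioo a b ×ˢ (univ : Set (EuclideanSpace ℝ (Fin 2))), g (e z) := by
    rw [← hpre]
    exact (he.setIntegral_preimage_emb e.measurableEmbedding g _).symm
  have hint : Integrable (fun z : ℝ × EuclideanSpace ℝ (Fin 2) => g (e z)) (volume.prod volume) :=
    (he.integrable_comp_emb e.measurableEmbedding).2 hg
  rw [h1, Measure.volume_eq_prod, setIntegral_prod _ hint.integrableOn]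
  simp only [Measure.restrict_univ, heq]

/-- **Fubini on the slab**, heights inside: for `g` integrable on `ℝ³`,
`∫_{S(a,b)} g = ∫_y ∫_{c ∈ (a,b)} g (y₀, y₁, c)`. -/
theorem setIntegral_slab_eq_integral_setIntegral {g : EuclideanSpace ℝ (Fin 3) → F} (hg : Integrable g) (a b : ℝ) :
    ∫ x in {x : EuclideanSpace ℝ (Fin 3) | a < x 2 ∧ x 2 < b}, g x =
      ∫ y : EuclideanSpace ℝ (Fin 2), ∫ c in Ioo a b, g (toLp 2 ![y 0, y 1, c]) := by
  obtain ⟨e, he, heq⟩ := exists_slabChart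
  have hpre := preimage_slab_eq heq a b
  have h1 : ∫ x in {x : EuclideanSpace ℝ (Fin 3) | a < x 2 ∧ x 2 < b}, g x =
      ∫ z in Ioo a b ×ˢ (univ : Set (EuclideanSpace ℝ (Fin 2))), g (e z) := by
    rw [← hpre]
    exact (he.setIntegral_preimage_emb e.measurableEmbedding g _).symm
  have hint : Integrable (fun z : ℝ × EuclideanSpace ℝ (Fin 2) => g (e z)) (volume.prod volume) :=
    (he.integrable_comp_emb e.measurableEmbedding).2 hg
  have hres : (volume : Measure (ℝ × EuclideanSpace ℝ (Fin 2))).restrict (Ioo a b ×ˢ (univ : Set (EuclideanSpace ℝ (Fin 2)))) =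
      ((volume : Measure ℝ).restrict (Ioo a b)).prod (volume : Measure (EuclideanSpace ℝ (Fin 2))) := by
    rw [Measure.volume_eq_prod, ← Measure.prod_restrict, Measure.restrict_univ]
  have hint' : Integrable (fun z : ℝ × EuclideanSpace ℝ (Fin 2) => g (e z))
      (((volume : Measure ℝ).restrict (Ioo a b)).prod (volume : Measure (EuclideanSpace ℝ (Fin 2)))) := by
    rw [← hres, ← Measure.volume_eq_prod] at *
    exact hint.integrableOn
  rw [h1, hres, integral_prod_symm _ hint']
  simp only [heq]

omit [NormedSpace ℝ F] in
/-- Slices of an integrable function are integrable at almost every height: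
`y ↦ g (y₀, y₁, c)` is integrable on `ℝ²` for a.e. `c`. -/
theorem ae_integrable_slice {g : EuclideanSpace ℝ (Fin 3) → F} (hg : Integrable g) :
    ∀ᵐ c : ℝ, Integrable (fun y : EuclideanSpace ℝ (Fin 2) => g (toLp 2 ![y 0, y 1, c])) := by
  obtain ⟨e, he, heq⟩ := exists_slabChart
  have hint : Integrable (fun z : ℝ × EuclideanSpace ℝ (Fin 2) => g (e z)) (volume.prod volume) :=
    (he.integrable_comp_emb e.measurableEmbedding).2 hg
  filter_upwards [hint.prod_right_ae] with c hc
  simpa only [heq] using hc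

end Fubini

/-! ### The fundamental theorem of calculus across the slab -/

/-- **FTC across the slab.** For `φ ∈ C¹(ℝ³)` with `∂₂φ` integrable on `ℝ³` and the boundary
slices `y ↦ φ(y₀,y₁,a)`, `y ↦ φ(y₀,y₁,b)` integrable on `ℝ²` (`a ≤ b`):
`∫_{S(a,b)} ∂₂φ = ∫_y φ(y₀,y₁,b) − ∫_y φ(y₀,y₁,a)`. -/
theorem setIntegral_slab_fderiv_two {φ : EuclideanSpace ℝ (Fin 3) → ℝ} (hφ : ContDiff ℝ 1 φ)
    (hint : Integrable fun x => fderiv ℝ φ x (EuclideanSpace.single 2 1)) {a b : ℝ} (hab : a ≤ b)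
    (ha : Integrable fun y : EuclideanSpace ℝ (Fin 2) => φ (toLp 2 ![y 0, y 1, a]))
    (hb : Integrable fun y : EuclideanSpace ℝ (Fin 2) => φ (toLp 2 ![y 0, y 1, b])) :
    ∫ x in {x : EuclideanSpace ℝ (Fin 3) | a < x 2 ∧ x 2 < b}, fderiv ℝ φ x (EuclideanSpace.single 2 1) =
      (∫ y : EuclideanSpace ℝ (Fin 2), φ (toLp 2 ![y 0, y 1, b])) - ∫ y : EuclideanSpace ℝ (Fin 2), φ (toLp 2 ![y 0, y 1, a]) := by
  rw [setIntegral_slab_eq_integral_setIntegral hint, ← integral_sub hb ha]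
  refine integral_congr_ae (Eventually.of_forall fun y => ?_)
  -- FTC on the vertical line through `(y₀, y₁, ·)`
  have hderiv : ∀ c, HasDerivAt (fun c : ℝ => φ (toLp 2 ![y 0, y 1, c]))
      (fderiv ℝ φ (toLp 2 ![y 0, y 1, c]) (EuclideanSpace.single 2 1)) c := fun c =>
    ((hφ.differentiable one_ne_zero _).hasFDerivAt).comp_hasDerivAt c (hasDerivAt_toLp_vec3 y c)
  have hline : Continuous fun c : ℝ => (toLp 2 ![y 0, y 1, c] : EuclideanSpace ℝ (Fin 3)) :=
    continuous_iff_continuousAt.2 fun c => (hasDerivAt_toLp_vec3 y c).continuousAt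
  have hcont : Continuous fun c : ℝ => fderiv ℝ φ (toLp 2 ![y 0, y 1, c])
      (EuclideanSpace.single 2 1) :=
    ((hφ.continuous_fderiv one_ne_zero).comp hline).clm_apply continuous_const
  have hFTC := intervalIntegral.integral_eq_sub_of_hasDerivAt (fun c _ => hderiv c)
    (hcont.intervalIntegrable a b)
  rwa [intervalIntegral.integral_of_le hab, integral_Ioc_eq_integral_Ioo] at hFTC

/-! ### In-plane derivatives integrate to zero -/

/-- **Whole-plane integration by parts on one slice.** If `ψ, ψ' : ℝ² → ℝ` are integrable and
`ψ' y` is the line derivative of `ψ` at every `y` in the direction `v`, then `∫ ψ' = 0` (Mathlib's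
integration by parts against the constant `1`; no boundary terms on the whole plane). -/
theorem integral_eq_zero_of_hasLineDerivAt {ψ ψ' : EuclideanSpace ℝ (Fin 2) → ℝ} (v : EuclideanSpace ℝ (Fin 2)) (hψ : Integrable ψ)
    (hψ' : Integrable ψ') (hderiv : ∀ y, HasLineDerivAt ℝ ψ (ψ' y) y v) : ∫ y, ψ' y = 0 := by
  have h := integral_bilinear_hasLineDerivAt_right_eq_neg_left_of_integrable (μ := volume)
    (f := fun _ : EuclideanSpace ℝ (Fin 2) => (1 : ℝ)) (f' := fun _ => (0 : ℝ)) (g := ψ) (g' := ψ') (v := v)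
    (B := ContinuousLinearMap.mul ℝ ℝ) ?_ ?_ ?_ ?_ ?_
  · simpa using h
  · simp
  · simpa using hψ'
  · simpa using hψ
  · intro y _
    simpa using (hasFDerivAt_const (1 : ℝ) y).hasLineDerivAt v
  · intro y _
    exact hderiv y

/-- **In-plane derivatives integrate to zero over the slab**, direction `e₀`: for `φ ∈ C¹(ℝ³)`
with `φ` and `∂₀φ` integrable on `ℝ³`, `∫_{S(a,b)} ∂₀φ = 0` (Fubini, then whole-plane integration
by parts on almost every slice). -/
theorem setIntegral_slab_fderiv_zero {φ : EuclideanSpace ℝ (Fin 3) → ℝ} (hφ : ContDiff ℝ 1 φ) (hint₀ : Integrable φ)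
    (hint : Integrable fun x => fderiv ℝ φ x (EuclideanSpace.single 0 1)) (a b : ℝ) :
    ∫ x in {x : EuclideanSpace ℝ (Fin 3) | a < x 2 ∧ x 2 < b}, fderiv ℝ φ x (EuclideanSpace.single 0 1) = 0 := by
  rw [setIntegral_slab_eq_integral_integral hint]
  have hae : ∀ᵐ c : ℝ,
      ∫ y : EuclideanSpace ℝ (Fin 2), fderiv ℝ φ (toLp 2 ![y 0, y 1, c]) (EuclideanSpace.single 0 1) = 0 := by
    filter_upwards [ae_integrable_slice hint₀, ae_integrable_slice hint] with c hc hc'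
    refine integral_eq_zero_of_hasLineDerivAt (EuclideanSpace.single 0 1) hc hc' fun y => ?_
    show HasDerivAt (fun t : ℝ => φ (toLp 2 ![(y + t • EuclideanSpace.single 0 1 : EuclideanSpace ℝ (Fin 2)) 0,
      (y + t • EuclideanSpace.single 0 1 : EuclideanSpace ℝ (Fin 2)) 1, c])) _ 0
    simp_rw [toLp_vec3_add_smul_single_zero]
    exact ((hφ.differentiable one_ne_zero _).hasFDerivAt).hasLineDerivAt _
  rw [integral_congr_ae (ae_restrict_of_ae (s := Ioo a b) hae), integral_zero]

/-- **In-plane derivatives integrate to zero over the slab**, direction `e₁`: for `φ ∈ C¹(ℝ³)`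
with `φ` and `∂₁φ` integrable on `ℝ³`, `∫_{S(a,b)} ∂₁φ = 0`. -/
theorem setIntegral_slab_fderiv_one {φ : EuclideanSpace ℝ (Fin 3) → ℝ} (hφ : ContDiff ℝ 1 φ) (hint₀ : Integrable φ)
    (hint : Integrable fun x => fderiv ℝ φ x (EuclideanSpace.single 1 1)) (a b : ℝ) :
    ∫ x in {x : EuclideanSpace ℝ (Fin 3) | a < x 2 ∧ x 2 < b}, fderiv ℝ φ x (EuclideanSpace.single 1 1) = 0 := by
  rw [setIntegral_slab_eq_integral_integral hint]
  have hae : ∀ᵐ c : ℝ,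
      ∫ y : EuclideanSpace ℝ (Fin 2), fderiv ℝ φ (toLp 2 ![y 0, y 1, c]) (EuclideanSpace.single 1 1) = 0 := by
    filter_upwards [ae_integrable_slice hint₀, ae_integrable_slice hint] with c hc hc'
    refine integral_eq_zero_of_hasLineDerivAt (EuclideanSpace.single 1 1) hc hc' fun y => ?_
    show HasDerivAt (fun t : ℝ => φ (toLp 2 ![(y + t • EuclideanSpace.single 1 1 : EuclideanSpace ℝ (Fin 2)) 0,
      (y + t • EuclideanSpace.single 1 1 : EuclideanSpace ℝ (Fin 2)) 1, c])) _ 0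
    simp_rw [toLp_vec3_add_smul_single_one]
    exact ((hφ.differentiable one_ne_zero _).hasFDerivAt).hasLineDerivAt _
  rw [integral_congr_ae (ae_restrict_of_ae (s := Ioo a b) hae), integral_zero]

/-! ### Integrability from polynomial decay -/

section Decay

variable {F : Type*} [NormedAddCommGroup F]

/-- The plane parametrisation `y ↦ (y₀, y₁, c)` is continuous. -/
theorem continuous_toLp_vec3_left (c : ℝ) :
    Continuous fun y : EuclideanSpace ℝ (Fin 2) => (toLp 2 ![y 0, y 1, c] : EuclideanSpace ℝ (Fin 3)) := by
  fun_prop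

/-- The weight `(1 + ‖x‖)⁻⁴` is positive. -/
theorem weight_pos {X : Type*} [SeminormedAddCommGroup X] (x : X) :
    0 < (1 + ‖x‖) ^ (-(4 : ℝ)) :=
  Real.rpow_pos_of_pos (by positivity) _

/-- The weight `(1 + ‖x‖)⁻⁴` is at most `1`. -/
theorem weight_le_one {X : Type*} [SeminormedAddCommGroup X] (x : X) :
    (1 + ‖x‖) ^ (-(4 : ℝ)) ≤ 1 :=
  Real.rpow_le_one_of_one_le_of_nonpos (by simp) (by norm_num)

/-- A constant dominating a norm through the positive weight is nonnegative. -/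
theorem nonneg_of_norm_le_weight {X : Type*} [SeminormedAddCommGroup X] {g : X → F}
    {C : ℝ} (h : ∀ x, ‖g x‖ ≤ C * (1 + ‖x‖) ^ (-(4 : ℝ))) : 0 ≤ C := by
  have h0 := h 0
  have hw := weight_pos (0 : X)
  nlinarith [norm_nonneg (g 0)]

/-- A continuous `g` on `ℝ³` with `‖g x‖ ≤ C (1 + ‖x‖)⁻⁴` is integrable (`4 > 3 = dim ℝ³`; Mathlib
`integrable_one_add_norm`). -/
theorem integrable_of_norm_le_weight {g : EuclideanSpace ℝ (Fin 3) → F} (hg : Continuous g) {C : ℝ}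
    (h : ∀ x, ‖g x‖ ≤ C * (1 + ‖x‖) ^ (-(4 : ℝ))) : Integrable g := by
  have hr : (Module.finrank ℝ (EuclideanSpace ℝ (Fin 3)) : ℝ) < 4 := by
    rw [finrank_euclideanSpace, Fintype.card_fin]; norm_num
  exact Integrable.mono' ((integrable_one_add_norm hr).const_mul C) hg.aestronglyMeasurable
    (Eventually.of_forall h)

/-- A continuous `g` on `ℝ³` with `‖g x‖ ≤ C (1 + ‖x‖)⁻⁴` has integrable slices
`y ↦ g (y₀, y₁, c)` on `ℝ²` (`‖y‖ ≤ ‖(y₀,y₁,c)‖` and `4 > 2 = dim ℝ²`). -/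
theorem integrable_slice_of_norm_le_weight {g : EuclideanSpace ℝ (Fin 3) → F} (hg : Continuous g) {C : ℝ}
    (h : ∀ x, ‖g x‖ ≤ C * (1 + ‖x‖) ^ (-(4 : ℝ))) (c : ℝ) :
    Integrable fun y : EuclideanSpace ℝ (Fin 2) => g (toLp 2 ![y 0, y 1, c]) := by
  have hC : 0 ≤ C := nonneg_of_norm_le_weight h
  have hr : (Module.finrank ℝ (EuclideanSpace ℝ (Fin 2)) : ℝ) < 4 := by
    rw [finrank_euclideanSpace, Fintype.card_fin]; norm_num
  refine Integrable.mono' ((integrable_one_add_norm hr).const_mul C)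
    (hg.comp (continuous_toLp_vec3_left c)).aestronglyMeasurable (Eventually.of_forall fun y => ?_)
  calc ‖g (toLp 2 ![y 0, y 1, c])‖ ≤ C * (1 + ‖(toLp 2 ![y 0, y 1, c] : EuclideanSpace ℝ (Fin 3))‖) ^ (-(4 : ℝ)) := h _
    _ ≤ C * (1 + ‖y‖) ^ (-(4 : ℝ)) := by
        gcongr C * ?_
        exact Real.rpow_le_rpow_of_nonpos (by positivity)
          (by linarith [norm_le_norm_toLp_vec3 y c]) (by norm_num)

end Decay

/-! ### The divergence theorem on the slab -/

/-- **Divergence theorem on the slab `S(a,b)`.** For `φ₀, φ₁, φ₂ ∈ C¹(ℝ³)` with `φⱼ` and `∂ⱼφⱼ`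
integrable on `ℝ³` and the boundary slices of `φ₂` at heights `a ≤ b` integrable on `ℝ²`:
`Σⱼ ∫_{S(a,b)} ∂ⱼφⱼ = ∫_y φ₂(y₀,y₁,b) − ∫_y φ₂(y₀,y₁,a)` — the in-plane terms vanish and the
vertical one is the flux through the two bounding planes. -/
theorem sum_setIntegral_slab_fderiv {φ : Fin 3 → EuclideanSpace ℝ (Fin 3) → ℝ} (hφ : ∀ j, ContDiff ℝ 1 (φ j))
    (hint₀ : ∀ j, Integrable (φ j))
    (hint : ∀ j, Integrable fun x => fderiv ℝ (φ j) x (EuclideanSpace.single j 1)) {a b : ℝ}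
    (hab : a ≤ b) (ha : Integrable fun y : EuclideanSpace ℝ (Fin 2) => φ 2 (toLp 2 ![y 0, y 1, a]))
    (hb : Integrable fun y : EuclideanSpace ℝ (Fin 2) => φ 2 (toLp 2 ![y 0, y 1, b])) :
    ∑ j, ∫ x in {x : EuclideanSpace ℝ (Fin 3) | a < x 2 ∧ x 2 < b}, fderiv ℝ (φ j) x (EuclideanSpace.single j 1) =
      (∫ y : EuclideanSpace ℝ (Fin 2), φ 2 (toLp 2 ![y 0, y 1, b])) - ∫ y : EuclideanSpace ℝ (Fin 2), φ 2 (toLp 2 ![y 0, y 1, a]) := by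
  rw [Fin.sum_univ_three, setIntegral_slab_fderiv_zero (hφ 0) (hint₀ 0) (hint 0),
    setIntegral_slab_fderiv_one (hφ 1) (hint₀ 1) (hint 1),
    setIntegral_slab_fderiv_two (hφ 2) (hint 2) hab ha hb, zero_add, zero_add]

end Summit.NavierStokesRegularity.NavierStokesRegularity.Theorems.PlaneEnergyCeilingSlabEnergyIdentity

end
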